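import Literature.Barriers.ValiantsHypothesis.FullRankMultilinearRank
import HarnessLib

/-!
# The partial derivative matrix of a product of variable-disjoint polynomials: relative rank
# bound (Raz 2006, Prop. 3.2, the half used for lower bounds)

Support file for the partial-derivative-matrix method (`FullRankMultilinear*.lean`).
[Raz2006, Prop. 3.2]: if `f = f₁ f₂` with `f₁`, `f₂` on disjoint sets of variables then
`Rank(M_f) = Rank(M_{f₁}) · Rank(M_{f₂})` ("the matrix `M_f` is the tensor product of `M_{f₁}` and
`M_{f₂}`").  The tree's `AKV.rank_cm_mul_le` records the absolute consequence
`rank M_{Y,Z}(g h) ≤ 2^{|Z ∩ Sᶜ| + |Y ∩ S|}` used by Alon–Kumar–Volk; the log-product route to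
Raz's multilinear FORMULA lower bound needs the RELATIVE half, which we prove here in the `cm`
formalism (coefficient matrices indexed by all pairs of finite sets, [AlonKumarVolk2020, §2.2]):

* `rank_cm_mul_le_rank_mul_pow` — for `g ∈ K[Sᶜ]`, `h ∈ K[S]` and any `Y`, `Z`:
  `rank M_{Y,Z}(g h) ≤ rank M_{Y,Z}(g) · 2^{|Z ∩ S|}` (`M_{Y,Z}(gh)` is a sum over the `2^{|Z ∩ S|}`
  column patterns `B ⊆ Z ∩ S` of row/column-rescaled submatrices of `M_{Y,Z}(g)`);
  `rank_cm_mul_le_rank_mul_pow'` — the same with `2^{|Y ∩ S|}` (transpose);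
  `rank_cm_mul_le_rank_mul_pow_min` — hence with `2^{min(|Y ∩ S|, |Z ∩ S|)} ≥ rank M_{Y,Z}(h)`'s
  trivial bound, i.e. the usable inequality `rank M(gh) ≤ rank M(g) · min(#rows, #cols of M(h))`;
* `rank_cm_prod_le` — for a LOG-PRODUCT `∏_{j ∈ J} g_j` with pairwise disjoint variable sets
  `X_j`: `rank M_{Y,Z}(∏ g_j) ≤ ∏_j 2^{min(|Y ∩ X_j|, |Z ∩ X_j|)}` — the rank bound of
  [Raz2006, Lemma 3.3] / of every "`k`-unbalanced" argument, ready for the cut-counting of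
  `FullRankMultilinearCutCounting.lean`.

## References
* [Raz2006] R. Raz, *Separation of multilinear circuit and formula size*, Theory of Computing 2
  (2006) 121–135, Prop. 3.1, Prop. 3.2, Lemma 3.3.
* [AlonKumarVolk2020] N. Alon, M. Kumar, B. L. Volk, Combinatorica 40 (2020), §2.2, Prop. 8.
-/

noncomputable section

namespace Literature.Barriers.ValiantsHypothesis.AKV

open MvPolynomial Finset RazYehudayoff

variable {K : Type*} [Field K] {σ : Type*} [Fintype σ] [DecidableEq σ]

/-- **Relative rank bound for a product of variable-disjoint polynomials (columns).**  For
`g ∈ K[Sᶜ]`, `h ∈ K[S]`: `rank M_{Y,Z}(g h) ≤ rank M_{Y,Z}(g) · 2^{|Z ∩ S|}`.  Proof: for `P ⊆ Y`,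
`Q ⊆ Z`, `M(gh)_{P,Q} = coeff_{(P∪Q)∩Sᶜ}(g) · coeff_{(P∪Q)∩S}(h)`; grouping the columns `Q` by
`B = Q ∩ S` writes `M(gh)` as a sum of `2^{|Z ∩ S|}` matrices
`diag(u_B) · M(g)[P ↦ P ∩ Sᶜ, Q ↦ Q ∩ Sᶜ] · diag(w_B)`, each of rank `≤ rank M(g)`.
[cite: Raz2006, Prop. 3.2] -/
theorem rank_cm_mul_le_rank_mul_pow {g h : MvPolynomial σ K} (S : Finset σ)
    (hg : g ∈ supported K (↑(Sᶜ) : Set σ)) (hh : h ∈ supported K (↑S : Set σ)) (Y Z : Finset σ) :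
    (cm (g * h) Y Z).rank ≤ (cm g Y Z).rank * 2 ^ (Z ∩ S).card := by
  classical
  -- row weights, column selectors, and the pieces
  let u : Finset σ → Finset σ → K := fun B P => if P ⊆ Y then coeff (ind (P ∩ S ∪ B)) h else 0
  let w : Finset σ → Finset σ → K := fun B Q => if Q ⊆ Z ∧ Q ∩ S = B then 1 else 0
  let N : Finset σ → Matrix (Finset σ) (Finset σ) K := fun B =>
    Matrix.diagonal (u B) * (cm g Y Z).submatrix (fun P => P ∩ Sᶜ) (fun Q => Q ∩ Sᶜ) *
      Matrix.diagonal (w B)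
  have hN : ∀ B P Q, N B P Q = u B P * cm g Y Z (P ∩ Sᶜ) (Q ∩ Sᶜ) * w B Q := by
    intro B P Q
    simp only [N, Matrix.mul_diagonal, Matrix.diagonal_mul, Matrix.submatrix_apply]
  -- the decomposition
  have hdec : cm (g * h) Y Z = ∑ B ∈ (Z ∩ S).powerset, N B := by
    ext P Q
    rw [Matrix.sum_apply]
    simp only [hN]
    by_cases hPQ : P ⊆ Y ∧ Q ⊆ Z
    · conv_lhs => rw [cm_apply, if_pos hPQ]
      rw [Finset.sum_eq_single (Q ∩ S)]
      · have hu : u (Q ∩ S) P = coeff (ind (P ∩ S ∪ Q ∩ S)) h := by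
          simp only [u]; rw [if_pos hPQ.1]
        have hw : w (Q ∩ S) Q = 1 := by simp [w, hPQ.2]
        have hcm : cm g Y Z (P ∩ Sᶜ) (Q ∩ Sᶜ) = coeff (ind (P ∩ Sᶜ ∪ Q ∩ Sᶜ)) g := by
          rw [cm_apply, if_pos ⟨(Finset.inter_subset_left).trans hPQ.1,
            (Finset.inter_subset_left).trans hPQ.2⟩]
        have hsplit : P ∪ Q = (P ∩ Sᶜ ∪ Q ∩ Sᶜ) ∪ (P ∩ S ∪ Q ∩ S) := by
          ext x
          simp only [Finset.mem_union, Finset.mem_inter, Finset.mem_compl]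
          tauto
        rw [hu, hw, hcm, mul_one, hsplit,
          coeff_ind_union_mul (W₁ := Sᶜ) (W₂ := S) disjoint_compl_left hg hh, mul_comm]
        · exact Finset.union_subset Finset.inter_subset_right Finset.inter_subset_right
        · exact Finset.union_subset Finset.inter_subset_right Finset.inter_subset_right
      · intro B _ hB
        have hw : w B Q = 0 := by
          simp only [w]; rw [if_neg]; exact fun h' => hB h'.2.symm
        rw [hw, mul_zero]
      · intro hB
        exact absurd (Finset.mem_powerset.2 (Finset.inter_subset_inter hPQ.2 (subset_refl _))) hB
    · conv_lhs => rw [cm_apply, if_neg hPQ]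
      symm
      refine Finset.sum_eq_zero fun B _ => ?_
      by_cases hP : P ⊆ Y
      · have hw : w B Q = 0 := by
          simp only [w]; rw [if_neg]; exact fun h' => hPQ ⟨hP, h'.1⟩
        rw [hw, mul_zero]
      · have hu : u B P = 0 := by
          simp only [u]; rw [if_neg hP]
        rw [hu, zero_mul, zero_mul]
  -- ranks
  have hrank : ∀ B, (N B).rank ≤ (cm g Y Z).rank := fun B =>
    calc (N B).rank ≤ (Matrix.diagonal (u B) *
          (cm g Y Z).submatrix (fun P => P ∩ Sᶜ) (fun Q => Q ∩ Sᶜ)).rank := Matrix.rank_mul_le_left _ _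
      _ ≤ ((cm g Y Z).submatrix (fun P => P ∩ Sᶜ) (fun Q => Q ∩ Sᶜ)).rank := Matrix.rank_mul_le_right _ _
      _ ≤ (cm g Y Z).rank := Matrix.rank_submatrix_le _ _ _
  rw [hdec]
  calc (∑ B ∈ (Z ∩ S).powerset, N B).rank ≤ ∑ B ∈ (Z ∩ S).powerset, (N B).rank := rank_sum_le' _ _
    _ ≤ ∑ _B ∈ (Z ∩ S).powerset, (cm g Y Z).rank := Finset.sum_le_sum fun B _ => hrank B
    _ = (cm g Y Z).rank * 2 ^ (Z ∩ S).card := by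
        rw [Finset.sum_const, smul_eq_mul, Finset.card_powerset, mul_comm]

/-- **Relative rank bound (rows).**  For `g ∈ K[Sᶜ]`, `h ∈ K[S]`:
`rank M_{Y,Z}(g h) ≤ rank M_{Y,Z}(g) · 2^{|Y ∩ S|}` (transpose of the column bound).
[cite: Raz2006, Prop. 3.2] -/
theorem rank_cm_mul_le_rank_mul_pow' {g h : MvPolynomial σ K} (S : Finset σ)
    (hg : g ∈ supported K (↑(Sᶜ) : Set σ)) (hh : h ∈ supported K (↑S : Set σ)) (Y Z : Finset σ) :
    (cm (g * h) Y Z).rank ≤ (cm g Y Z).rank * 2 ^ (Y ∩ S).card := by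
  rw [rank_cm_swap (g * h), rank_cm_swap g]
  exact rank_cm_mul_le_rank_mul_pow S hg hh Z Y

/-- **Relative rank bound, symmetric form**: `rank M_{Y,Z}(g h) ≤ rank M_{Y,Z}(g) ·
2^{min(|Y ∩ S|, |Z ∩ S|)}` for `g ∈ K[Sᶜ]`, `h ∈ K[S]` — multiplying by a polynomial in fresh
variables `S` costs at most the trivial rank bound `min(#rows, #cols)` of its own matrix.
[cite: Raz2006, Prop. 3.2] -/
theorem rank_cm_mul_le_rank_mul_pow_min {g h : MvPolynomial σ K} (S : Finset σ)
    (hg : g ∈ supported K (↑(Sᶜ) : Set σ)) (hh : h ∈ supported K (↑S : Set σ)) (Y Z : Finset σ) :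
    (cm (g * h) Y Z).rank ≤ (cm g Y Z).rank * 2 ^ min (Y ∩ S).card (Z ∩ S).card := by
  rcases le_total (Y ∩ S).card (Z ∩ S).card with hle | hle
  · rw [min_eq_left hle]; exact rank_cm_mul_le_rank_mul_pow' S hg hh Y Z
  · rw [min_eq_right hle]; exact rank_cm_mul_le_rank_mul_pow S hg hh Y Z

/-- The constant polynomial `1` has `rank M_{Y,Z}(1) ≤ 1`. [cite: Raz2006, Prop. 3.1] -/
theorem rank_cm_one_le (Y Z : Finset σ) : (cm (1 : MvPolynomial σ K) Y Z).rank ≤ 1 := by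
  have h1 : (1 : MvPolynomial σ K) ∈ supported K (↑(∅ : Finset σ) : Set σ) :=
    Subalgebra.one_mem _
  simpa using rank_cm_le_pow_of_supported h1 Y Z

/-- **Rank of a log-product** ([Raz2006, Lemma 3.3]'s mechanism): if the `g_j` (`j ∈ J`) are
polynomials in pairwise disjoint sets of variables `X_j`, then for every `Y`, `Z`
`rank M_{Y,Z}(∏_j g_j) ≤ ∏_j 2^{min(|Y ∩ X_j|, |Z ∩ X_j|)}`: every factor that is unbalanced under
the cut `(Y, Z)` loses rank exponentially in its imbalance. [cite: Raz2006, Prop. 3.2 and Lemma 3.3] -/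
theorem rank_cm_prod_le {ι : Type*} [DecidableEq ι] (J : Finset ι) (X : ι → Finset σ)
    (g : ι → MvPolynomial σ K) (hg : ∀ j ∈ J, g j ∈ supported K (↑(X j) : Set σ))
    (hdisj : (J : Set ι).PairwiseDisjoint X) (Y Z : Finset σ) :
    (cm (∏ j ∈ J, g j) Y Z).rank ≤ ∏ j ∈ J, 2 ^ min (Y ∩ X j).card (Z ∩ X j).card := by
  classical
  induction J using Finset.induction_on with
  | empty => simpa using rank_cm_one_le (K := K) Y Z
  | insert j₀ J hj₀ ih =>
    have hdisj' : (J : Set ι).PairwiseDisjoint X :=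
      hdisj.subset (by simp [Finset.coe_insert, Set.subset_insert])
    have hg' : ∀ j ∈ J, g j ∈ supported K (↑(X j) : Set σ) := fun j hj => hg j (mem_insert_of_mem hj)
    -- the remaining product lives in the variables `(X j₀)ᶜ`
    have hrest : ∏ j ∈ J, g j ∈ supported K (↑((X j₀)ᶜ) : Set σ) := by
      refine Subalgebra.prod_mem _ fun j hj => supported_mono ?_ (hg' j hj)
      have hd : Disjoint (X j₀) (X j) :=
        hdisj (by simp) (by simp [hj]) (fun h => hj₀ (h ▸ hj))
      intro x hx
      rw [Finset.coe_compl, Set.mem_compl_iff, Finset.mem_coe]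
      exact fun hx0 => Finset.disjoint_left.1 hd hx0 (Finset.mem_coe.1 hx)
    rw [Finset.prod_insert hj₀, Finset.prod_insert hj₀, mul_comm (g j₀), mul_comm (2 ^ _)]
    exact (rank_cm_mul_le_rank_mul_pow_min (X j₀) hrest (hg j₀ (mem_insert_self _ _)) Y Z).trans
      (Nat.mul_le_mul_right _ (ih hg' hdisj'))

end Literature.Barriers.ValiantsHypothesis.AKV
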